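import Summits.CriticalPhenomena.PercolationContinuityZ3.Theorems.PercNearOneGluingNoHeavyLowerTailSahiLogDerivEndC3
import Summits.CriticalPhenomena.PercolationContinuityZ3.Theorems.SahiMasterFamilyCoordPolyPeel

/-!
# The fibre cubic of `E_3` at a face-vanishing coordinate: `E_3(μ_{p[e↦s]}) = s(1−s)(c₁ − c₃ s)`

Unit `prim-masterthm-p4` (gen 11; crux anchor stmt-CriticalPhenomena-4575, helper work; memo
`run/shared/lean/prim/prim-masterthm/prim-masterthm-p4/FACE-QUOTIENT-3.md`).  For three real functions `f, g, h` on configurations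
and a product measure, `s ↦ E_3(μ_{p[e↦s]}; f,g,h)` is the tree's cubic `cubicE3` (`sahiE_three_update_eq`), whose linear
coefficient is prim-bnk-2's `SahiLogDerivEnd.derivE3AtZero` (`c₁ = Φ′(0)`, the "bottom slope") and whose cubic coefficient is
`c₃ = secDelta f · secDelta g · secDelta h` (product of the three influences, `secDelta = X₁ − X₀`).  We prove:

* `cubicE3_eq_monomial` — the monomial form with all four coefficients explicit;
* **`cubicE3_eq_of_ends_zero`** — if `Φ(0) = Φ(1) = 0` (both `e`-minors have `E_3 = 0` at this base point — the situation at
  EVERY coordinate of a face-vanishing triple) then `Φ(s) = s(1−s)(c₁ − c₃ s)` EXACTLY: the quotient `E_3 / (p_e(1−p_e))` is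
  AFFINE in `p_e`, and STRICTLY DECREASING when `e` is pivotal for all three increasing events (`c₃ > 0`, `fibreTop_ind_pos`);
* consequences at a common pivotal, face-vanishing coordinate (`U` increasing, `p` interior):
  `exists_sahiE_three_update_pos_iff` — `E_3 > 0` somewhere on the fibre `⟺ c₁ > 0`;
  `forall_sahiE_three_update_nonneg_iff` — `E_3 ≥ 0` on the whole fibre `⟺ c₃ ≤ c₁`;
  `forall_sahiE_three_update_nonpos_iff` — `E_3 ≤ 0` on the open fibre `⟺ c₁ ≤ 0`.
So on the face-vanishing class both Kahn/Sahi positivity `C₃` and the weak positivity statement (P3+)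
(`SahiE3PositiveSomewhere`, prim-masterthm-p4 gen 10) are statements about ONE number per fibre.  HONEST FRAMING: identities and
equivalences only; (P3+), Sahi `C_k` / Kahn's Conjecture 5 and the master theorem remain OPEN. [this work]
-/

noncomputable section

open scoped Classical

namespace Summit.CriticalPhenomena.PercolationContinuityZ3.Theorems

open Finset Function
open Literature.Combinatorics.Sahi2008
open Literature.Probability.Percolation.DecisionTree (ind ind_of_mem ind_of_not_mem ind_nonneg)
open SahiLogDerivEnd (derivE3AtZero sahiE_three_ind_update_eq cubicE3_zero_eq_secAt)

namespace FibreCubic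

variable {ι : Type*} [Fintype ι]

/-! ### The monomial form with explicit coefficients -/

/-- **The fibre cubic in the monomial basis, all coefficients explicit**: `Φ(s) = Φ(0) + c₁ s + c₂ s² + c₃ s³` with
`c₁ = derivE3AtZero`, `c₃ = Δf·Δg·Δh` (`Δ = secDelta p e`) and the displayed `c₂`. [this work] -/
theorem cubicE3_eq_monomial (p : ι → unitInterval) (e : ι) (f g h : Set ι → ℝ) (s : ℝ) :
    cubicE3 p e f g h s =
      cubicE3 p e f g h 0 + derivE3AtZero p e f g h * s +
        ((secDelta p e f * secDelta p e g * secEx p e h false + secDelta p e f * secEx p e g false * secDelta p e h +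
              secEx p e f false * secDelta p e g * secDelta p e h) -
            (secDelta p e f * secDelta p e (g * h) + secDelta p e g * secDelta p e (f * h) +
              secDelta p e h * secDelta p e (f * g))) * s ^ 2 +
        secDelta p e f * secDelta p e g * secDelta p e h * s ^ 3 := by
  simp only [cubicE3, derivE3AtZero, secDelta]
  ring

/-- **Face-vanishing factorisation of the fibre cubic**: if `Φ(0) = 0` and `Φ(1) = 0` then `Φ(s) = s(1−s)(c₁ − c₃ s)` for every
real `s` — the quotient `Φ(s)/(s(1−s))` is affine with slope `−c₃ = −Δf·Δg·Δh`. [this work] -/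
theorem cubicE3_eq_of_ends_zero (p : ι → unitInterval) (e : ι) (f g h : Set ι → ℝ)
    (h0 : cubicE3 p e f g h 0 = 0) (h1 : cubicE3 p e f g h 1 = 0) (s : ℝ) :
    cubicE3 p e f g h s =
      s * (1 - s) * (derivE3AtZero p e f g h - secDelta p e f * secDelta p e g * secDelta p e h * s) := by
  have h1' := cubicE3_eq_monomial p e f g h 1
  rw [h1, h0] at h1'
  rw [cubicE3_eq_monomial, h0]
  -- eliminate the quadratic coefficient using `Φ(1) = 0`
  have h2 : (secDelta p e f * secDelta p e g * secEx p e h false + secDelta p e f * secEx p e g false * secDelta p e h +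
        secEx p e f false * secDelta p e g * secDelta p e h) -
      (secDelta p e f * secDelta p e (g * h) + secDelta p e g * secDelta p e (f * h) + secDelta p e h * secDelta p e (f * g)) =
      -derivE3AtZero p e f g h - secDelta p e f * secDelta p e g * secDelta p e h := by
    linarith
  rw [h2]; ring

/-! ### Event triples: `E_3` on the fibre over a base point -/

section Events

variable (p : ι → unitInterval) (e : ι) (U : Fin 3 → Set (Set ι))

/-- The fibre cubic at `1` is `E_3` of the `1`-sections (contractions) under the original measure (companion of
`SahiLogDerivEnd.cubicE3_zero_eq_secAt`). [this work] -/
theorem cubicE3_one_eq_secAt :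
    cubicE3 p e (ind (U 0)) (ind (U 1)) (ind (U 2)) 1 = sahiE (bernoulliWeight p) 3 (fun j => ind (secAt e true (U j))) := by
  have h1 : ((boolParam true : unitInterval) : ℝ) = 1 := by simp [boolParam]
  rw [← h1, ← sahiE_three_ind_update_eq, sahiE_three_update_boolParam,
    sahiE_three_secAt_update p e true (boolParam true) (p e), update_eq_self]

/-- **`E_3` on a face-vanishing fibre.**  If both `e`-minors of the triple have `E_3(μ_p) = 0` at the base point `p`, then for
every `s ∈ [0,1]`: `E_3(μ_{p[e↦s]}; 1_U) = s(1−s)(c₁ − c₃ s)` with `c₁ = derivE3AtZero` and `c₃ = ∏_j secDelta p e (1_{U_j})`. [this work] -/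
theorem sahiE_three_ind_update_eq_of_sec_zero
    (h0 : sahiE (bernoulliWeight p) 3 (fun j => ind (secAt e false (U j))) = 0)
    (h1 : sahiE (bernoulliWeight p) 3 (fun j => ind (secAt e true (U j))) = 0) (s : unitInterval) :
    sahiE (bernoulliWeight (update p e s)) 3 (fun j => ind (U j)) =
      (s : ℝ) * (1 - (s : ℝ)) *
        (derivE3AtZero p e (ind (U 0)) (ind (U 1)) (ind (U 2)) -
          secDelta p e (ind (U 0)) * secDelta p e (ind (U 1)) * secDelta p e (ind (U 2)) * (s : ℝ)) := by
  rw [sahiE_three_ind_update_eq]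
  refine cubicE3_eq_of_ends_zero p e _ _ _ ?_ ?_ (s : ℝ)
  · rw [cubicE3_zero_eq_secAt, h0]
  · rw [cubicE3_one_eq_secAt, h1]

variable {p e U}

/-- At a coordinate pivotal for all three increasing events, the cubic coefficient `c₃ = ∏_j secDelta p e (1_{U_j})`
(product of the three influences) is positive in the open cube. [this work] -/
theorem fibreTop_ind_pos (hp : ∀ i, (p i : ℝ) ∈ Set.Ioo (0 : ℝ) 1) (hU : ∀ j, IsUpperSet (U j))
    (he : ∀ j, ∃ ω, e ∉ ω ∧ ω ∉ U j ∧ insert e ω ∈ U j) :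
    0 < secDelta p e (ind (U 0)) * secDelta p e (ind (U 1)) * secDelta p e (ind (U 2)) := by
  unfold secDelta
  exact mul_pos (mul_pos (secEx_ind_sub_pos hp e (hU 0) (he 0)) (secEx_ind_sub_pos hp e (hU 1) (he 1)))
    (secEx_ind_sub_pos hp e (hU 2) (he 2))

/-- **Positivity somewhere on a face-vanishing fibre ⟺ positive bottom slope.**  At a coordinate `e` pivotal for all three
increasing events, over an interior base point at which both `e`-minors have `E_3 = 0`:
`(∃ s ∈ (0,1), E_3(μ_{p[e↦s]}; 1_U) > 0) ⟺ c₁ > 0`. [this work] -/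
theorem exists_sahiE_three_update_pos_iff (hp : ∀ i, (p i : ℝ) ∈ Set.Ioo (0 : ℝ) 1) (hU : ∀ j, IsUpperSet (U j))
    (he : ∀ j, ∃ ω, e ∉ ω ∧ ω ∉ U j ∧ insert e ω ∈ U j)
    (h0 : sahiE (bernoulliWeight p) 3 (fun j => ind (secAt e false (U j))) = 0)
    (h1 : sahiE (bernoulliWeight p) 3 (fun j => ind (secAt e true (U j))) = 0) :
    (∃ s : unitInterval, (s : ℝ) ∈ Set.Ioo (0 : ℝ) 1 ∧ 0 < sahiE (bernoulliWeight (update p e s)) 3 (fun j => ind (U j))) ↔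
      0 < derivE3AtZero p e (ind (U 0)) (ind (U 1)) (ind (U 2)) := by
  set c₁ := derivE3AtZero p e (ind (U 0)) (ind (U 1)) (ind (U 2)) with hc₁
  set c₃ := secDelta p e (ind (U 0)) * secDelta p e (ind (U 1)) * secDelta p e (ind (U 2)) with hc₃
  have hc3 : 0 < c₃ := fibreTop_ind_pos hp hU he
  constructor
  · rintro ⟨s, hs, hpos⟩
    rw [sahiE_three_ind_update_eq_of_sec_zero p e U h0 h1 s] at hpos
    have hss : 0 < (s : ℝ) * (1 - (s : ℝ)) := mul_pos hs.1 (by linarith [hs.2])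
    have hlin : 0 < c₁ - c₃ * (s : ℝ) := by
      by_contra hle
      push Not at hle
      have := mul_nonpos_of_nonneg_of_nonpos hss.le hle
      linarith
    nlinarith [hs.1]
  · intro hc1
    -- the point `s₀ = min (1/2) (c₁ / (2 c₃)) ∈ (0,1)`
    set x : ℝ := min (1 / 2) (c₁ / (2 * c₃)) with hx
    have hx0 : 0 < x := lt_min (by norm_num) (div_pos hc1 (by linarith))
    have hx1 : x < 1 := lt_of_le_of_lt (min_le_left _ _) (by norm_num)
    have hxle : x ≤ c₁ / (2 * c₃) := min_le_right _ _
    refine ⟨⟨x, hx0.le, hx1.le⟩, ⟨hx0, hx1⟩, ?_⟩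
    rw [sahiE_three_ind_update_eq_of_sec_zero p e U h0 h1]
    simp only []
    have hlin : 0 < c₁ - c₃ * x := by
      have : c₃ * x ≤ c₃ * (c₁ / (2 * c₃)) := mul_le_mul_of_nonneg_left hxle hc3.le
      have h' : c₃ * (c₁ / (2 * c₃)) = c₁ / 2 := by field_simp
      linarith
    exact mul_pos (mul_pos hx0 (by linarith)) hlin

/-- **Nonnegativity on a whole face-vanishing fibre ⟺ `c₃ ≤ c₁`** (same hypotheses).  Since the quotient
`E_3/(s(1−s)) = c₁ − c₃ s` decreases from `c₁` at `s = 0` to `c₁ − c₃` at `s = 1`, Kahn/Sahi positivity on the fibre is the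
single inequality at its TOP end. [this work] -/
theorem forall_sahiE_three_update_nonneg_iff (hp : ∀ i, (p i : ℝ) ∈ Set.Ioo (0 : ℝ) 1) (hU : ∀ j, IsUpperSet (U j))
    (he : ∀ j, ∃ ω, e ∉ ω ∧ ω ∉ U j ∧ insert e ω ∈ U j)
    (h0 : sahiE (bernoulliWeight p) 3 (fun j => ind (secAt e false (U j))) = 0)
    (h1 : sahiE (bernoulliWeight p) 3 (fun j => ind (secAt e true (U j))) = 0) :
    (∀ s : unitInterval, 0 ≤ sahiE (bernoulliWeight (update p e s)) 3 (fun j => ind (U j))) ↔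
      secDelta p e (ind (U 0)) * secDelta p e (ind (U 1)) * secDelta p e (ind (U 2)) ≤
        derivE3AtZero p e (ind (U 0)) (ind (U 1)) (ind (U 2)) := by
  set c₁ := derivE3AtZero p e (ind (U 0)) (ind (U 1)) (ind (U 2)) with hc₁
  set c₃ := secDelta p e (ind (U 0)) * secDelta p e (ind (U 1)) * secDelta p e (ind (U 2)) with hc₃
  have hc3 : 0 < c₃ := fibreTop_ind_pos hp hU he
  constructor
  · intro hall
    by_contra hlt
    push Not at hlt
    -- the point `s₁ = max (1/2) ((1 + c₁/c₃)/2) ∈ (0,1)` has `c₁ − c₃ s₁ < 0`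
    set x : ℝ := max (1 / 2) ((1 + c₁ / c₃) / 2) with hx
    have hx0 : 0 < x := lt_of_lt_of_le (by norm_num) (le_max_left _ _)
    have hlt' : c₁ / c₃ < 1 := (div_lt_one hc3).2 hlt
    have hx1 : x < 1 := max_lt (by norm_num) (by linarith)
    have hxge : (1 + c₁ / c₃) / 2 ≤ x := le_max_right _ _
    have hneg : c₁ - c₃ * x < 0 := by
      have h' : c₃ * ((1 + c₁ / c₃) / 2) = (c₃ + c₁) / 2 := by field_simp
      have : c₃ * ((1 + c₁ / c₃) / 2) ≤ c₃ * x := mul_le_mul_of_nonneg_left hxge hc3.le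
      linarith
    have hval := hall ⟨x, hx0.le, hx1.le⟩
    rw [sahiE_three_ind_update_eq_of_sec_zero p e U h0 h1] at hval
    have : (x * (1 - x)) * (c₁ - c₃ * x) < 0 := mul_neg_of_pos_of_neg (mul_pos hx0 (by linarith)) hneg
    exact absurd hval (not_le.2 this)
  · intro hle s
    rw [sahiE_three_ind_update_eq_of_sec_zero p e U h0 h1 s]
    have hs0 : 0 ≤ (s : ℝ) := s.2.1
    have hs1 : (s : ℝ) ≤ 1 := s.2.2
    have hlin : 0 ≤ c₁ - c₃ * (s : ℝ) := by nlinarith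
    exact mul_nonneg (mul_nonneg hs0 (by linarith)) hlin

/-- **Non-positivity on the open face-vanishing fibre ⟺ `c₁ ≤ 0`** (same hypotheses): the form in which the fibre enters the
weak positivity statement (P3+) `SahiE3PositiveSomewhere` ("`E_3 ≤ 0` on the open cube forces a zero flag"). [this work] -/
theorem forall_sahiE_three_update_nonpos_iff (hp : ∀ i, (p i : ℝ) ∈ Set.Ioo (0 : ℝ) 1) (hU : ∀ j, IsUpperSet (U j))
    (he : ∀ j, ∃ ω, e ∉ ω ∧ ω ∉ U j ∧ insert e ω ∈ U j)
    (h0 : sahiE (bernoulliWeight p) 3 (fun j => ind (secAt e false (U j))) = 0)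
    (h1 : sahiE (bernoulliWeight p) 3 (fun j => ind (secAt e true (U j))) = 0) :
    (∀ s : unitInterval, (s : ℝ) ∈ Set.Ioo (0 : ℝ) 1 → sahiE (bernoulliWeight (update p e s)) 3 (fun j => ind (U j)) ≤ 0) ↔
      derivE3AtZero p e (ind (U 0)) (ind (U 1)) (ind (U 2)) ≤ 0 := by
  constructor
  · intro hall
    by_contra hpos
    push Not at hpos
    obtain ⟨s, hs, hs'⟩ := (exists_sahiE_three_update_pos_iff hp hU he h0 h1).2 hpos
    exact absurd (hall s hs) (not_le.2 hs')
  · intro hle s hs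
    rw [sahiE_three_ind_update_eq_of_sec_zero p e U h0 h1 s]
    have hc3 := fibreTop_ind_pos hp hU he
    have hlin : derivE3AtZero p e (ind (U 0)) (ind (U 1)) (ind (U 2)) -
        secDelta p e (ind (U 0)) * secDelta p e (ind (U 1)) * secDelta p e (ind (U 2)) * (s : ℝ) ≤ 0 := by
      nlinarith [hs.1]
    exact mul_nonpos_of_nonneg_of_nonpos (mul_nonneg hs.1.le (by linarith [hs.2])) hlin

end Events

end FibreCubic

end Summit.CriticalPhenomena.PercolationContinuityZ3.Theorems
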